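import Summits.ResolutionOfSingularities.ResolutionOfSingularities.Theses.UniversalCells
import Summits.ResolutionOfSingularities.ResolutionOfSingularities.Theorems.UniversalCellsLocalToGlobalHSTowerDefs
import Summits.ResolutionOfSingularities.ResolutionOfSingularities.Theorems.UniversalCellsLocalToGlobalStepRegularOverRegular
import Summits.ResolutionOfSingularities.ResolutionOfSingularities.Theorems.UniversalCellsLocalToGlobalIsOpenResolvedOver
import Summits.ResolutionOfSingularities.ResolutionOfSingularities.Theorems.UniversalCellsLocalToGlobalExistsStageOfPointwise
import Summits.ResolutionOfSingularities.ResolutionOfSingularities.Theorems.UniversalCellsLocalToGlobalHasResolutionOfIsRegularIter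
import Summits.ResolutionOfSingularities.ResolutionOfSingularities.Theorems.UniversalCellsLocalToGlobalReduceToNormalization
import HarnessLib

/-!
# `LocalToGlobal` (crux stmt-ResolutionOfSingularities-15232, route UniversalCells), line `Sketch`
# (idea `existence-certified-termination`) — CERTIFICATE: the crux is closed modulo the atom `HSTransfer`

Helper file (`--supports stmt-ResolutionOfSingularities-15232`; registered stub
`stub_localToGlobal_of_hsTransfer`; does not close the item).

**Statement.** If for every prime `p`, every normal variety `V` over `𝔽_p` with `dim V < N` all
of whose points have an open neighbourhood admitting a resolution has its blind lex-maximal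
Hilbert–Samuel tower (`NormalVariety.step`, `Theorems/UniversalCellsLocalToGlobalHSTowerDefs.lean`)
eventually regular over every point (`IsResolvedOver` — the conclusion of the line's ATOM
`stub_hsTransfer`, here an explicit hypothesis), then `UniversalCells.LocalToGlobal` holds.

**Proof (the line's composition, every other stub landed).** Given `H_p` and an integral
separated finite-type `X/𝔽_p`: replace `X` by its normalization `V` with a level `N > dim V`
(`stub_reduce_to_normalization`, p165617); `H_p` applies to `V` itself, so the hypothesis gives
pointwise termination; the step is an isomorphism over the regular locus
(`stub_step_regular_over_regular`, p165613), whence the resolved-over loci increase with the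
stage (`isResolvedOver_succ`, by induction on the stage generalizing `V`); they are open
(`stub_isOpen_resolvedOver`, p165638), so by quasi-compactness one stage `V_n` is regular over
every point (`stub_exists_stage_of_pointwise`, p165615), i.e. regular, and `V_n → V` is proper
birational, so `V`, hence `X`, has a resolution (`stub_hasResolution_of_isRegular_iter`, p165585).
No two resolutions are ever compared (cf. `Theorems/LocalToGlobal/Negative/ResolutionsNotRigid.lean`).
-/

set_option linter.dupNamespace false -- mandated namespace of this single-conjunct summit

noncomputable section

open CategoryTheory AlgebraicGeometry TopologicalSpace Topology
open Literature.AlgebraicGeometry.Resolution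

namespace Summit.ResolutionOfSingularities.ResolutionOfSingularities.Theorems.LocalToGlobal.HSTower

/-- **Monotonicity of the resolved-over loci along the blind tower**: if stage `n` is regular
over `x ∈ V` then so is stage `n + 1` — by induction on `n` generalizing `V`
(`V_{n+2} = (V₁)_{n+1}`), the base case being "the step is an isomorphism over the regular
locus" (`stub_step_regular_over_regular`). [folklore] -/
theorem isResolvedOver_succ {k : Type} [Field k] (N : ℕ) :
    ∀ (n : ℕ) (V : NormalVariety k) (x : V.X),
      V.IsResolvedOver N n x → V.IsResolvedOver N (n + 1) x := by
  intro n
  induction n with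
  | zero =>
    intro V x h y hy
    have e : NormalVariety.iterπ N (0 + 1) V = V.stepπ N := Category.id_comp _
    rw [e] at hy
    exact stub_step_regular_over_regular k V N y (h _ hy)
  | succ n ih =>
    intro V x h y hy
    have key : ∀ x₁ : (V.step N).X, (V.stepπ N).base x₁ = x →
        (V.step N).IsResolvedOver N n x₁ := by
      intro x₁ hx₁ z hz
      refine h z ?_
      rw [NormalVariety.iterπ_succ_apply, hz, hx₁]
    have hy' : (V.stepπ N).base ((NormalVariety.iterπ N (n + 1) (V.step N)).base y) = x := by
      rw [NormalVariety.iterπ_succ_apply] at hy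
      exact hy
    exact ih (V.step N) _ (key _ hy') y rfl

/-- **Stub `stub_localToGlobal_of_hsTransfer` (CERTIFICATE): the crux `LocalToGlobal` is closed
modulo the atom `HSTransfer`.** Pointwise termination of the blind lex-maximal Hilbert–Samuel
tower on pointwise-locally-resolvable normal varieties over prime fields implies
`UniversalCells.LocalToGlobal` (normalize; atom; monotone open exhaustion of a quasi-compact
space; a regular stage is a resolution). [folklore] -/
theorem stub_localToGlobal_of_hsTransfer
    (hT : ∀ (p : ℕ) [Fact p.Prime] (V : NormalVariety (ZMod p)) (N : ℕ),
      topologicalKrullDim V.X < (N : WithBot ℕ∞) →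
      (∀ x : V.X, ∃ U : V.X.Opens, x ∈ U ∧ Scheme.HasResolution (U : Scheme.{0})) →
      ∀ x : V.X, ∃ n : ℕ, V.IsResolvedOver N n x) :
    Summit.ResolutionOfSingularities.ResolutionOfSingularities.Theses.UniversalCells.LocalToGlobal := by
  intro p hp hloc X f hs hl hq hi
  haveI : Fact p.Prime := ⟨hp⟩
  obtain ⟨V, N, hN, hdesc⟩ := stub_reduce_to_normalization (ZMod p) X f
  refine hdesc ?_
  have hlocV : ∀ x : V.X, ∃ U : V.X.Opens, x ∈ U ∧ Scheme.HasResolution (U : Scheme.{0}) :=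
    hloc V.X V.hom V.isSeparated V.locallyOfFiniteType V.quasiCompact V.isIntegral
  obtain ⟨n, hn⟩ := stub_exists_stage_of_pointwise (ZMod p) V N
    (fun n => isResolvedOver_succ N n V) (stub_isOpen_resolvedOver (ZMod p) V N)
    (hT p V N hN hlocV)
  refine stub_hasResolution_of_isRegular_iter (ZMod p) N n V fun y => ?_
  exact hn ((NormalVariety.iterπ N n V).base y) y rfl

end Summit.ResolutionOfSingularities.ResolutionOfSingularities.Theorems.LocalToGlobal.HSTower

end
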